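import Mathlib
import HarnessLib
import HarnessLib.Audit
import Summits.AtomisticToContinuum.Statement
import Literature.MathematicalPhysics.StatisticalMechanics.LennardJonesClusters
import Literature.Geometry.DiscreteGeometry.KissingPatterns
import HarnessLib.Audit.Status.Attr

/-!
Route: TwoCentreKissing

CLOSED (retired) 2026-08-15T13:47:21Z by operator:999:1257524 — reason: not-a-thesis: assembly does not conclude the sub-problem Statement — note: D-0027 §2.1 audit (human 2026-08-15: routes that do not decide the summit are removed): the assembly concludes `Literature.MathematicalPhysics.StatisticalMechanics.Crystallization`, not the sub-problem statement; a NEW conforming route may be opened from the same idea (generated `closes : … → _root_. The file is kept as the record of this route; refuted decls are indexed as negative knowledge (`ledger negatives`).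

# Route TwoCentreKissing — Flatley–Theil's two-centre kissing conjecture as a gap-free,
Flyspeck-free rigidity kernel for Lennard-Jones crystallization

Realises card flatley-theil-conjecture-two-sphere-sdp. It suffices to show X = X_geo ∧ X_LJ ∧
X_hinge (plus the shared conjunct-(i) items):
X_geo (TWO-CENTRE KERNEL, pure metric geometry, no potential, NO annulus/gap hypothesis):
Flatley–Theil's Conjecture 2.2 — two touching points z, z' of a 1-separated set, each with exactly
twelve unit-distance neighbours, share ≥ 4 neighbours (TwoCentreFourCommon) — in its soft form at
tolerance η ≤ 1/1000 (SoftTwoCentreFourCommon), together with the effective 24-tangency rigidity of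
twelve kissing balls (RobustTangencyBound), gives GapFreeShellRigidity: if a point and its twelve
soft neighbours are all exactly-twelve soft-coordinated, its shell is 1/10-close (after a rotation)
to the FCC or the HCP kissing pattern. Mechanism: ≥ 4 common neighbours per touching pair = minimum
degree 4 in the shell's contact graph = 24 tangencies = cuboctahedron/anticuboctahedron
(FlatleyTheil2015 Thm 3.5 = FlatleyEtAl2013), which is exactly the role of Flatley–Theil's
three-body term V₃.
X_LJ (BOND ORDER): Lennard-Jones ground states in ℝ³ have one bond length a: all but o(N) particles
are (1−10⁻³)a-separated from every other particle and have exactly twelve particles within (1+10⁻³)a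
(BondOrderTwelve). With X_geo this yields the route target LocalClosePacking (all but o(N) first
shells FCC/HCP-close; glue BondToShells).
X_hinge: locally close-packed Lennard-Jones ground states crystallize positionally
(ClosePackedCrystallizes: LocalClosePacking → LennardJonesMinimalDistance → IsCrystallizing
lennardJones 3; content = stacking selection, shared in spirit with CrystalKissingRigidity K3 / Hägg
domination 0716, 0737).
With the shared conjunct-(i) items CrysPeriodicMinAttained (0627) and CrysEnergyLimit (0626) the
proved assembly lemma crystallization_of_isLeast_tendsto_isCrystallizing gives Crystallization.
Lean: `LocalClosePacking ∧ ClosePackedCrystallizes ∧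
Literature.MathematicalPhysics.StatisticalMechanics.LennardJonesMinimalDistance ∧
CrysPeriodicMinAttained ∧ CrysEnergyLimit`

## Assembly
Pure logic on top of the proved lemma
Literature.StatMech.crystallization_of_isLeast_tendsto_isCrystallizing
(Theorems/CrystalLocalRigidityAssembly.lean): BondToShells turns BondOrderTwelve +
GapFreeShellRigidity into LocalClosePacking; ClosePackedCrystallizes with the named fact
LennardJonesMinimalDistance gives IsCrystallizing; with CrysPeriodicMinAttained and CrysEnergyLimit
the lemma yields Crystallization. TwoCentreFourCommon heads the chain as the η = 0 section of the
kernel's input (SoftTwoCentreFourCommon at η = 0 is literally it) and the route's kill switch; it is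
not consumed by the glue term (checked in the planner's Sketch.lean: the assembly term is proved by
`fun _ hC hB hBS hCP hmin hper hlim => crystallization_of_isLeast_tendsto_isCrystallizing ⟨hper,
hlim, hCP (hBS hB hC) hmin⟩`).

Rationale: WHY THIS LINE. Flatley–Theil (FlatleyTheil2015 = arXiv:1407.0692, §2.1 p.7) isolate ONE finite
geometric statement, Conjecture 2.2, that would delete the three-body term from the only energetic
crystallization theorem in ℝ³ (their Thm 1.1): V₃ is used solely to force 24 tangencies in every
twelve-shell, and "≥ 4 common neighbours for touching twelve-coordinated pairs" forces the same by
degree counting plus the 24-tangency theorem (FlatleyEtAl2013 = doi:10.1016/j.cam.2013.03.036,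
computer-assisted). New observation filed with this route: Hales's gap lemma is LOCAL — flyspeck_L12
at a twelve-kissed point z already puts every non-neighbour of z at distance ≥ 1.26 (78.1° on a
touching neighbour's kissing sphere) — so, given L12, Conjecture 2.2 DECOUPLES into a one-sphere
spherical-CAP code bound (no 12-point 60°-code on S² with a pole having ≤ 3 points at 60° and all
others at ≥ 78.1°; hand constructions reach 10 points only), precisely the object of Barg–Musin
(doi:10.3934/amc.2007.1.131) and Bachoc–Vallentin cap-SDP (doi:10.1016/j.ejc.2008.07.017); L12-free,
it is the card's coupled two-sphere distinguished-point SDP (arXiv:math/0608426, arXiv:1311.3789,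
rational certificates doi:10.1137/20m1351692). Imported area: spherical codes / Delsarte–SDP duality
and certified computation. What it does that the existing routes do not: CrystalKissingRigidity's
kernel K2 (0758) ASSUMES an empty annulus (1+η, 5/4) around every particle and inherits
Hales2012_contactGraphTame + flyspeck_L12 (XL named facts, unverifiable in Lean at present); here
the annulus hypothesis is dropped (first-shell data only: BondOrderTwelve is strictly weaker than
0750) and the kernel reduces to three SMALL finite certificates (soft kissing ≤ 12, two-centre ≥ 4,
24-tangency rigidity) that can be kernel-checked; CrystalLocalRigidity asks instead for a
Flyspeck-type local ENERGY inequality. Tolerance 1/1000 is forced from both sides: the LJ-optimal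
hcp is anisotropic (c/a ≠ √(8/3), bond-length split ~10⁻⁴, so every "for all η" bond statement is
false), while the soft L12 gap 1.26 − 24η dies at η ≈ 1/100.

RANKED CRUXES. #0 LocalClosePacking (target) — Route target X₁: there is a bond length a > 0 such
that in Lennard-Jones ground states all but o(N) particles have their soft first shell (particles
within (1+10⁻³)a, recentred and scaled by 1/a) 1/10-close after a rotation to the FCC or the HCP
kissing pattern. Follows from BondOrderTwelve + GapFreeShellRigidity (glue BondToShells). (why it
might fail: fails iff LJ bulk is not close-packed at tolerance 10⁻³ for a positive fraction of
particles (persistent icosahedral/Frank–Kasper order), i.e. iff BondOrderTwelve fails or the kernel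
tolerance is too large.) [FlatleyTheil2015, BlancLewin2015, Hales2012]
#2 TwoCentreFourCommon (crux) — Flatley–Theil Conjecture 2.2 verbatim (card item F1/F2): for Z ⊂ ℝ³
with pairwise distances ≥ 1, N(z) = points of Z at distance exactly 1; if dist(z,z') = 1 and #N(z) =
#N(z') = 12 then #(N(z) ∩ N(z')) ≥ 4. First attack: with flyspeck_L12 (gap 1.26 at z) it is a
one-sphere cap-code bound (Barg–Musin / Bachoc–Vallentin SDP or Leech-type area count);
unconditional: coupled two-sphere distinguished-point SDP with phantom caps arccos(d/2), or interval
branch-and-bound over ≤ 23 balls. A proof conditional on flyspeck_L12 is worth landing as a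
--supports lemma but does not close the item. [difficulty: L] (why it might fail: Unattempted in
print; margins are Tammes-13-thin (57.1° vs 60°): a ≤ 23-ball configuration with two touching
12-kissed centres sharing 3 neighbours may exist (non-common neighbours of z' pushed to ≥ 78° from
z, z's far side free).) [arXiv:1407.0692 §2.1 Conjecture 2.2, doi:10.1016/j.cam.2013.03.036,
doi:10.3934/amc.2007.1.131, doi:10.1016/j.ejc.2008.07.017, arXiv:math/0608426, arXiv:1209.6043 Lemma
1-2, Literature.Geometry.DiscreteGeometry.flyspeck_L12]
#3 GapFreeShellRigidity (crux) — THE KERNEL (gap-free robust Fejes Tóth step, tolerance η ∈ [0,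
1/1000]): if S ⊂ ℝ³ is (1−η)-separated on the ball B(x,4), and x ∈ S and every point of S within 1+η
of x have exactly twelve points of S within 1+η, then the soft shell of x (translated to the origin)
is 1/10-close after a linear isometry to fccKissingPattern or hcpKissingPattern. Intended proof =
KernelGlue: SoftTwoCentreFourCommon gives every shell point ≥ 4 soft tangencies inside the shell,
hence ≥ 48 ordered soft-tangent pairs, and RobustTangencyBound concludes. η = 0: Conjecture 2.2 +
FTTT 24-tangency equality case. [deps: TwoCentreFourCommon, SoftTwoCentreFourCommon,
RobustTangencyBound] [difficulty: L] (why it might fail: Needs Conj. 2.2 AND effective slack: the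
24-tangency theorem (FTTT 2013) and FT Prop 3.3 are proved only at η=0 / ineffective α₀; a 12-shell
with 25 soft tangencies or a 1/10-far 24-tangency shell at η=10⁻³ kills this constant (re-cut
smaller).) [doi:10.1016/j.cam.2013.03.036, arXiv:1407.0692 Prop 3.3 and Thm 3.5, arXiv:1209.6043 Thm
3 Lemma 9-10, Literature.Barriers.AtomisticToContinuum.FlexibleKissingArrangementsNarrow,
arXiv:1611.10297]
#4 BondOrderTwelve (crux) — LJ BOND ORDER (first-shell only; strictly weaker than 0750 — no empty
annulus (1+η, 5/4) is claimed): there is a > 0 such that for every sequence of Lennard-Jones ground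
states x^N in ℝ³ the fraction of particles i failing [(1−10⁻³)a ≤ dist(x_i, x_j) for all j ≠ i, and
exactly twelve j with dist(x_i,x_j) ≤ (1+10⁻³)a] tends to 0. Expected a ≈ 0.971 (bulk LJ
nearest-neighbour distance). Mechanism: soft kissing bound caps the count at 12 (Tammes-13 margin
57.14° < 59.86°; SDP-certifiable, or L12), energy accounting E(N) ≤ N e_hcp + O(N^(2/3)) with the
bond/elastic/tail split forces 12 bonds and strain < 10⁻³ away from o(N) defects. [difficulty: XL]
(why it might fail: False iff a positive fraction of LJ bulk particles is not 12-coordinated within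
0.1% (polytetrahedral order; LJ13 is icosahedral) or bulk strain ≥10⁻³ persists; proof needs an
energy→coordination inequality nobody has in 3-D (BlancLewin2015 §2.3).) [arXiv:1504.01153 §2.2-2.3,
arXiv:1209.6043 Lemma 1, arXiv:1605.00034 §3,
Literature.Barriers.AtomisticToContinuum.IcosahedralClusters, arXiv:1705.01751,
stmt-AtomisticToContinuum-0750]
#5 ClosePackedCrystallizes (crux) — HINGE: if Lennard-Jones ground states are locally close-packed
(LocalClosePacking) and uniformly separated (LennardJonesMinimalDistance, named fact), then
IsCrystallizing lennardJones 3: local limits of translated ground states are windows of one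
lattice-periodic configuration. Content: FCC/HCP-close shells ⇒ combinatorial Barlow layering
(HalesDSP §1.3, discharged in tree as HalesDSP_layerPackings_holds at η = 0) ⇒ stacking selection by
the r⁻⁶ tail (Hägg domination 0716/0737 + certified interlayer couplings 0670) ⇒ periodic (HCP-type)
limit. [deps: LocalClosePacking] [difficulty: XL] (why it might fail: Stacking blindness:
close-packed shells never fix the stacking (KissingTwelveDegeneracy); if optimal LJ stackings are
aperiodic (Hägg domination fails, |J₂|≈7e-5 uncertified) the implication is false even though
LocalClosePacking holds.) [Literature.Barriers.AtomisticToContinuum.KissingTwelveDegeneracy,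
Literature.Barriers.AtomisticToContinuum.ShortRangeStackingBlindness,
stmt-AtomisticToContinuum-0716, stmt-AtomisticToContinuum-0737, arXiv:1705.01751, HalesDSP2012 §1.3]
#9 SoftTwoCentreFourCommon (support) — Soft two-centre lemma, tolerance η ∈ [0, 1/1000] (η = 0 is
literally TwoCentreFourCommon): Z (1−η)-separated, z ≠ z' with dist ≤ 1+η, each with exactly twelve
other points within 1+η ⇒ ≥ 4 points within 1+η of both. From TwoCentreFourCommon + kissing number
twelve only an ineffective η₀ follows by compactness (limit 13th contact excluded by k(3)=12); the
explicit 1/1000 needs the certificate with slack (soft L12 gap 1.26−24η = 1.236 at η = 10⁻³ keeps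
the cap-code reduction alive). [difficulty: L] [arXiv:1407.0692 Conjecture 2.2, arXiv:1209.6043
Lemma 1-2, doi:10.1016/j.ejc.2008.07.017]
#9 RobustTangencyBound (support) — Effective 24-tangency rigidity (FT Thm 3.5 = FTTT 2013 with
explicit slack; FT Prop 3.3(2) made effective): for η ∈ [0, 1/1000], twelve points with norms in
[1−η, 1+η], pairwise ≥ 1−η, and ≥ 48 ordered pairs at distance ≤ 1+η are 1/10-close after a linear
isometry to the FCC or the HCP kissing pattern. In the kernel's setting the soft L12 gap makes the
shell a soft class-𝒱 configuration, where node degree ≤ 4 is in tree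
(IsKissingConfig.degree_le_four) and the 4-regular case of Hales's Lemma 9 classification
(TameContactGraphs.lean) is the natural Lean route. [difficulty: L] [doi:10.1016/j.cam.2013.03.036,
arXiv:1407.0692 Prop 3.3, arXiv:1209.6043 Lemma 9-10,
Literature.Geometry.DiscreteGeometry.kissingConfigCongruent_of_contactGraphFccOrHcp]
#9 KernelGlue (support) — Glue of the foreseen split of GapFreeShellRigidity:
SoftTwoCentreFourCommon → RobustTangencyBound → GapFreeShellRigidity (apply the soft lemma to Z = S
∩ B(x,4) and each pair (x,y), y a soft neighbour: ≥ 4 soft-common neighbours give y−x ≥ 4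
soft-tangent partners in the translated shell T, card T = 12, so ≥ 48 ordered pairs). Finite-set
bookkeeping, provable now. [difficulty: provable-now] [arXiv:1407.0692 §2.1 (remark after Conjecture
2.2)]
#9 BondToShells (support) — Glue: BondOrderTwelve → GapFreeShellRigidity → LocalClosePacking.
Rescale a ground state by 1/a; a particle whose (4a)-neighbourhood consists of bond-good particles
satisfies the kernel's hypotheses at η = 10⁻³; each bond-bad particle spoils ≤ (4.5/0.4995)³ good
ones (volume packing), so o(N) bad ⇒ o(N) non-close-packed; ground states are injective so index
sets and point sets match. [difficulty: M] [arXiv:1504.01153 §2.1]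
#9 CrysPeriodicMinAttained (support) — Shared item stmt-AtomisticToContinuum-0627 (identical
signature): the infimum over periodic configurations of ℝ³ of the Lennard-Jones energy per particle
is attained. Conjunct (i) input, not this route's focus. [difficulty: XL] [arXiv:1504.01153 §2.5,
stmt-AtomisticToContinuum-0627]
#9 CrysEnergyLimit (support) — Shared item stmt-AtomisticToContinuum-0626 (identical signature):
E(N)/N → ⨅ over periodic configurations of the LJ energy per particle. Conjunct (i) input, not this
route's focus. [difficulty: XL] [arXiv:1504.01153 §2.1, stmt-AtomisticToContinuum-0626]

TWO-LAYER PLAN. Foreseen glued splits (nothing filed as children now; the glue statements are filed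
as support so the intended logic is typed):
GapFreeShellRigidity ⇐ SoftTwoCentreFourCommon → RobustTangencyBound → GapFreeShellRigidity
(KernelGlue), once TwoCentreFourCommon closes (its certificate, re-run with slack, is
SoftTwoCentreFourCommon).
LocalClosePacking ⇐ BondOrderTwelve → GapFreeShellRigidity → LocalClosePacking (BondToShells).
ClosePackedCrystallizes ⇐ (combinatorial Barlow layering of close-packed LJ limits) → (stacking
selection: HaggDominationAllRanges 0737 + certified J_k 0670 ⇒ HCP-type period-2 limit) →
ClosePackedCrystallizes — only after BondOrderTwelve or the kernel moves.
TwoCentreFourCommon itself: first a --supports lemma `flyspeck_L12 → TwoCentreFourCommon` via the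
one-sphere cap code (kit: SDP/LP feasibility of the 12-point code with a 78.1°-hole at ≤ 3
contacts), then the L12-free two-sphere certificate.

KILL CRITERIA. REFUTED TwoCentreFourCommon (an explicit unit-ball configuration: two touching
12-kissed centres sharing ≤ 3 neighbours) closes the route outright (close --reason
refuted:TwoCentreFourCommon): the soft lemma and the kernel's proof die with it, and the gap-free
thesis has no other engine. A 12-shell at tolerance 10⁻³ with ≥ 25 soft tangencies, or 24 tangencies
yet 1/10-far from both patterns, refutes RobustTangencyBound/GapFreeShellRigidity AT THIS CONSTANT ⇒
pivot = restate kernel, soft lemma, BondOrderTwelve and LocalClosePacking at 1/5000 (BondOrderTwelve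
is equally plausible at any tolerance above the hcp anisotropy ~10⁻⁴); a second failure below 1/5000
closes the route. BondOrderTwelve refuted (LJ bulk not twelve-coordinated) kills every
sphere-packing-heritage route (this one, CrystalKissingRigidity). ClosePackedCrystallizes refuted =
aperiodic optimal stacking = conjunct refuted (route RefuteCrystalPeriodicMin wins). If
CrystalKissingRigidity's 0758 and 0750 are both PROVED first, this route is superseded for the
summit (its crux 2 stays a Literature-worthy theorem).

NOT DECOMPOSED YET. The three certificates behind the kernel (soft kissing ≤ 12 at 10⁻³, the
two-centre SDP/branch-and-bound, the effective 24-tangency classification) are not itemised: they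
ride as --supports lemmas of TwoCentreFourCommon / RobustTangencyBound. No flyspeck_L12-conditional
statement is filed as an item (it would not close anything and would put an XL named fact in the
import cone); conditional lemmas land in Theorems as supports. The energy side of BondOrderTwelve
(bond/elastic/tail decomposition in 3-D, surface O(N^(2/3)), the value of a) and the whole interior
of ClosePackedCrystallizes (layering at positive tolerance, fault counting, Hägg domination, the
HCP-vs-FCC 10⁻⁴ selection) wait for crux 2 or 3 to move. Flatley–Theil's own pay-off (their Thm 1.1
with Ψ = 0 for the α-localized PAIR class — not Lennard-Jones, barrier
LocalizedPotentialsExcludeLennardJones) is deliberately not filed: it needs FT's 50-page apparatus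
vendored and does not serve the summit.

CHEAPEST FALSIFIER. Maximise N over 60°-codes on S² containing a pole p with at most 3 code points
at exactly 60° from p and every other point at ≥ 78.1° from p (nonlinear optimisation / SDP
feasibility, minutes on kit): N = 12 feasible ⇒ the L12 shortcut is dead and only the coupled
two-sphere problem remains; then run the coupled problem (≤ 23 balls, 3-common stratum) as an SDP
feasibility / random-restart packing search — a feasible point is a counterexample to Conjecture 2.2
and closes the route. Not run in this one-shot planning pass (hand constructions under the 78.1°
constraint reached 10 points, not 12).

NUMBERS. Contact angle 60°; Hales gap 2h₀ = 2.52 radii = 1.26 diameters ↔ 78.10° (Hales2012 Lemma 2,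
flyspeck_L12); soft L12 gap at tolerance η: 1.26 − 24η (empty at η ≈ 0.0104; 1.236 ↔ 76.3° at η =
10⁻³); Tammes(13) = 57.1367° vs soft contact angle 2·arcsin(0.999/2.002) = 59.86° at η = 10⁻³
(58.69° at 10⁻²); icosahedral shell edge/radius 1.0515 (30 tangencies appear at η ≈ 2.5%); BV SDP
kissing bound in dimension 3 ≈ 12.4; LJ bulk nearest-neighbour distance a ≈ 0.971, hcp c/a
anisotropy ~10⁻⁴ (bond-length split well below 10⁻³); FCC/HCP patterns: 24 tangencies = 48 ordered
pairs, node degree 4; closeness threshold 1/10 < 1/2 (pattern points are ≥ 1 apart, so matching is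
unambiguous).

DEFINITION REQUESTS. None: fccKissingPattern, hcpKissingPattern, ShellCloseTo
(KissingPatterns.lean), IsGroundState, lennardJones, IsCrystallizing, LennardJonesMinimalDistance
exist. Cite fact wanted (filed separately): FlatleyEtAl2013 = doi:10.1016/j.cam.2013.03.036, Theorem
(max 24 tangencies among twelve kissing balls; equality only cuboctahedron / twisted cuboctahedron)
as a named fact in Literature/Geometry/DiscreteGeometry.

Novelty: Searches (2026-08-15): lit read arXiv:1407.0692 (Conjecture 2.2 p.7, Prop 3.1/3.3, Thm 3.4/3.5
pp.9-10 read); lit search --source crossref "packing twelve spherical caps maximize tangencies" (8;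
FTTT 2013 found); --source zbmath "twelve neighbour packings unit balls" (2: Böröczky–Szabó
2015/2016) and "12-neighbour packings" with review; lit galaxy search "codes in spherical caps"
--star all (5: Bachoc SDP slides, Bachoc–Vallentin (4,10,1/6), Musin pd functions, Bezdek's book);
--source crossref "codes in spherical caps Barg Musin" (6: Barg–Musin 2007, Bachoc–Vallentin 2009);
lit search --hybrid "two touching balls twelve neighbours share four common neighbours
cuboctahedron" (6 books: Hales DSP pp.12-14, SPLAG — nothing on the two-ball statement); lit
frontier/bridges AtomisticToContinuum (kinetic-theory dominated, nothing relevant); lean search over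
the tree (Hales 2012 vendoring: flyspeck_L12, contactGraphTame named; Lemma 10, node degree ≤ 4, DSP
layers proved). Plus the two refuter audits on the card (citation cone of arXiv:1407.0692, 65 works:
nothing proves or refutes Conj. 2.2).
Nearest prior art found: arXiv:1407.0692 (the printed open conjecture and its intended use);
doi:10.1016/j.cam.2013.03.036 (24-tangency theorem, η = 0, computer-assisted); arXiv:1209.6043 +
doi:10.1007/s10474-015-0527-4 (the GLOBAL all-balls-12-kissed theorem); doi:10.3934/amc.2007.1.131
and doi:10.1016/j.ejc.2008.07.017 (LP/SDP bounds for codes in spherical caps — the tool, never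
pointed at th  [refs: 10.1016/j.cam.2013.03.036, 10.1007/s10474-015-0527-4, 10.3934/amc.2007.1.131, 10.1016/j.ejc.2008.07.017, 10.1137/20m1351692, 1407.0692, 1209.6043, math/0608426, 1311.3789, doi:10.1016/j.cam.2013.03.036, doi:10.1007/s10474-015-0527-4, doi:10.3934/amc.2007.1.131, doi:10.1016/j.ejc.2008.07.017, doi:10.1137/20m1351692]

Barriers (technique_class: two-centre kissing rigidity; cap-code SDP; certificates): - technique_class: two-centre kissing rigidity; cap-code SDP; certificates
- Literature.Barriers.AtomisticToContinuum.FlexibleKissingArrangements: APPLIES to any ONE-shell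
count-only inference (icosahedral witness, bond number 0, 1/40-far); evaded exactly as its narrowed
form prescribes (evasion (i) BOND COUNT): the kernel infers closeness from 24 tangencies, and the
tangencies come from the SECOND centre — two mutually touching twelve-coordinated points is the
minimal hypothesis under which flexibility should die; the icosahedral shell is excluded because its
centre's neighbours are not twelve-coordinated at tolerance 10⁻³ (their would-be bonds are 5% long).
- Literature.Barriers.AtomisticToContinuum.FlexibleKissingArrangementsNarrow: same; the narrowed
barrier names the 24-tangency theorem as the known evasion, which RobustTangencyBound makes
effective.
- Literature.Barriers.AtomisticToContinuum.KissingTwelveDegeneracy: APPLIES (every Barlow stacking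
is locally close-packed): the kernel and LocalClosePacking conclude only FCC-or-HCP shells, never a
stacking; selection is quarantined in ClosePackedCrystallizes (r⁻⁶ tail via interlayer couplings,
Hägg domination 0716/0737) — the declared residual risk, shared with every route of the sub-problem.
- Literature.Barriers.AtomisticToContinuum.ShortRangeStackingBlindness: APPLIES to the hinge only;
same quarantine (selection needs the tail beyond √(8/3), which the hinge's proof must use; the
kernel does not pretend otherwise).
- Li

History (route lifecycle, newest last):
- 2026-08-15T13:47:21Z · CLOSED retired — not-a-thesis: assembly does not conclude the sub-problem Statement (operator:999:1257524)

sub-problem: Crystallization · status: closed(retired) · opened planner-plancard-AtomisticToContinuum-Crystal-8023f413-0 2026-08-15T11:17:15Z · rev 0 · ledger route-AtomisticToContinuum-TwoCentreKissing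
GENERATED by the gate from the ledger (D-0016/17). Provers cite these decls: `theorem foo : Summit.AtomisticToContinuum.Crystallization.Theses.TwoCentreKissing.<Decl> := …` in Summits/AtomisticToContinuum/Crystallization/Theorems/<Name>.lean.
-/

namespace Summit.AtomisticToContinuum.Crystallization.Theses.TwoCentreKissing

open scoped BigOperators Topology Manifold Classical MeasureTheory ProbabilityTheory Matrix InnerProductSpace ComplexConjugate ContinuousMap
open Filter Set Function TopologicalSpace MeasureTheory

attribute [summit_statement] _root_.Crystallization

/-- item stmt-AtomisticToContinuum-3370 · target · rank 0 · closed · moot by None · by planner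
why it might fail: fails iff LJ bulk is not close-packed at tolerance 10⁻³ for a positive fraction of particles (persistent icosahedral/Frank–Kasper order), i.e. iff BondOrderTwelve fails or the kernel tolerance is too large.
sources: FlatleyTheil2015, BlancLewin2015, Hales2012
[target] Route target X₁: there is a bond length a > 0 such that in Lennard-Jones ground states all
but o(N) particles have their soft first shell (particles within (1+10⁻³)a, recentred and scaled by
1/a) 1/10-close after a rotation to the FCC or the HCP kissing pattern. Follows from BondOrderTwelve
+ GapFreeShellRigidity (glue BondToShells). -/
@[route_item "route-AtomisticToContinuum-TwoCentreKissing"]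
def LocalClosePacking : Prop :=
  ∃ a : ℝ, 0 < a ∧ ∀ x : (N : ℕ) → (Fin N → EuclideanSpace ℝ (Fin 3)), (∀ N, Literature.MathematicalPhysics.StatisticalMechanics.IsGroundState Literature.MathematicalPhysics.StatisticalMechanics.lennardJones (x N)) → Filter.Tendsto (fun N : ℕ => (Nat.card {i : Fin N // ¬ ∃ T : Finset (EuclideanSpace ℝ (Fin 3)), (↑T : Set (EuclideanSpace ℝ (Fin 3))) = (fun j : Fin N => a⁻¹ • (x N j - x N i)) '' {j : Fin N | j ≠ i ∧ dist (x N i) (x N j) ≤ (1 + 1 / 1000) * a} ∧ (Literature.Geometry.DiscreteGeometry.ShellCloseTo (1 / 10) T Literature.Geometry.DiscreteGeometry.fccKissingPattern ∨ Literature.Geometry.DiscreteGeometry.ShellCloseTo (1 / 10) T Literature.Geometry.DiscreteGeometry.hcpKissingPattern)} : ℝ) / N) Filter.atTop (nhds 0)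

/-- item stmt-AtomisticToContinuum-3371 · crux · rank 2 · closed · moot by None · by planner
why it might fail: Unattempted in print; margins are Tammes-13-thin (57.1° vs 60°): a ≤ 23-ball configuration with two touching 12-kissed centres sharing 3 neighbours may exist (non-common neighbours of z' pushed to ≥ 78° from z, z's far side free).
sources: arXiv:1407.0692 §2.1 Conjecture 2.2, doi:10.1016/j.cam.2013.03.036, doi:10.3934/amc.2007.1.131, doi:10.1016/j.ejc.2008.07.017, arXiv:math/0608426, arXiv:1209.6043 Lemma 1-2
[crux] Flatley–Theil Conjecture 2.2 verbatim (card item F1/F2): for Z ⊂ ℝ³ with pairwise distances ≥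
1, N(z) = points of Z at distance exactly 1; if dist(z,z') = 1 and #N(z) = #N(z') = 12 then #(N(z) ∩
N(z')) ≥ 4. First attack: with flyspeck_L12 (gap 1.26 at z) it is a one-sphere cap-code bound
(Barg–Musin / Bachoc–Vallentin SDP or Leech-type area count); unconditional: coupled two-sphere
distinguished-point SDP with phantom caps arccos(d/2), or interval branch-and-bound over ≤ 23 balls.
A proof conditional on flyspeck_L12 is worth landing as a --supports lemma but does not close the
item. [difficulty: L] -/
@[route_item "route-AtomisticToContinuum-TwoCentreKissing"]
def TwoCentreFourCommon : Prop :=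
  ∀ Z : Set (EuclideanSpace ℝ (Fin 3)), (∀ x ∈ Z, ∀ y ∈ Z, x ≠ y → 1 ≤ dist x y) → ∀ z ∈ Z, ∀ z' ∈ Z, dist z z' = 1 → {w ∈ Z | dist w z = 1}.ncard = 12 → {w ∈ Z | dist w z' = 1}.ncard = 12 → 4 ≤ {w ∈ Z | dist w z = 1 ∧ dist w z' = 1}.ncard

/-- item stmt-AtomisticToContinuum-3372 · crux · rank 3 · closed · moot by None · by planner
why it might fail: Needs Conj. 2.2 AND effective slack: the 24-tangency theorem (FTTT 2013) and FT Prop 3.3 are proved only at η=0 / ineffective α₀; a 12-shell with 25 soft tangencies or a 1/10-far 24-tangency shell at η=10⁻³ kills this constant (re-cut smaller).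
sources: doi:10.1016/j.cam.2013.03.036, arXiv:1407.0692 Prop 3.3 and Thm 3.5, arXiv:1209.6043 Thm 3 Lemma 9-10, Literature.Barriers.AtomisticToContinuum.FlexibleKissingArrangementsNarrow, arXiv:1611.10297
[crux] THE KERNEL (gap-free robust Fejes Tóth step, tolerance η ∈ [0, 1/1000]): if S ⊂ ℝ³ is
(1−η)-separated on the ball B(x,4), and x ∈ S and every point of S within 1+η of x have exactly
twelve points of S within 1+η, then the soft shell of x (translated to the origin) is 1/10-close
after a linear isometry to fccKissingPattern or hcpKissingPattern. Intended proof = KernelGlue: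
SoftTwoCentreFourCommon gives every shell point ≥ 4 soft tangencies inside the shell, hence ≥ 48
ordered soft-tangent pairs, and RobustTangencyBound concludes. η = 0: Conjecture 2.2 + FTTT
24-tangency equality case. [deps: TwoCentreFourCommon, SoftTwoCentreFourCommon, RobustTangencyBound]
[difficulty: L] -/
@[route_item "route-AtomisticToContinuum-TwoCentreKissing"]
def GapFreeShellRigidity : Prop :=
  ∀ η : ℝ, 0 ≤ η → η ≤ 1 / 1000 → ∀ (S : Set (EuclideanSpace ℝ (Fin 3))) (x : EuclideanSpace ℝ (Fin 3)), x ∈ S → (∀ y ∈ S, ∀ y' ∈ S, dist x y ≤ 4 → dist x y' ≤ 4 → y ≠ y' → 1 - η ≤ dist y y') → (∀ y ∈ S, dist x y ≤ 1 + η → {w ∈ S | w ≠ y ∧ dist y w ≤ 1 + η}.ncard = 12) → ∃ T : Finset (EuclideanSpace ℝ (Fin 3)), (↑T : Set (EuclideanSpace ℝ (Fin 3))) = (fun y => y - x) '' {y ∈ S | y ≠ x ∧ dist x y ≤ 1 + η} ∧ (Literature.Geometry.DiscreteGeometry.ShellCloseTo (1 / 10) T Literature.Geometry.DiscreteGeometry.fccKissingPattern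 ∨ Literature.Geometry.DiscreteGeometry.ShellCloseTo (1 / 10) T Literature.Geometry.DiscreteGeometry.hcpKissingPattern)

/-- item stmt-AtomisticToContinuum-3373 · crux · rank 4 · closed · moot by None · by planner
why it might fail: False iff a positive fraction of LJ bulk particles is not 12-coordinated within 0.1% (polytetrahedral order; LJ13 is icosahedral) or bulk strain ≥10⁻³ persists; proof needs an energy→coordination inequality nobody has in 3-D (BlancLewin2015 §2.3).
sources: arXiv:1504.01153 §2.2-2.3, arXiv:1209.6043 Lemma 1, arXiv:1605.00034 §3, Literature.Barriers.AtomisticToContinuum.IcosahedralClusters, arXiv:1705.01751, stmt-AtomisticToContinuum-0750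
[crux] LJ BOND ORDER (first-shell only; strictly weaker than 0750 — no empty annulus (1+η, 5/4) is
claimed): there is a > 0 such that for every sequence of Lennard-Jones ground states x^N in ℝ³ the
fraction of particles i failing [(1−10⁻³)a ≤ dist(x_i, x_j) for all j ≠ i, and exactly twelve j with
dist(x_i,x_j) ≤ (1+10⁻³)a] tends to 0. Expected a ≈ 0.971 (bulk LJ nearest-neighbour distance).
Mechanism: soft kissing bound caps the count at 12 (Tammes-13 margin 57.14° < 59.86°;
SDP-certifiable, or L12), energy accounting E(N) ≤ N e_hcp + O(N^(2/3)) with the bond/elastic/tail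
split forces 12 bonds and strain < 10⁻³ away from o(N) defects. [difficulty: XL] -/
@[route_item "route-AtomisticToContinuum-TwoCentreKissing"]
def BondOrderTwelve : Prop :=
  ∃ a : ℝ, 0 < a ∧ ∀ x : (N : ℕ) → (Fin N → EuclideanSpace ℝ (Fin 3)), (∀ N, Literature.MathematicalPhysics.StatisticalMechanics.IsGroundState Literature.MathematicalPhysics.StatisticalMechanics.lennardJones (x N)) → Filter.Tendsto (fun N : ℕ => (Nat.card {i : Fin N // ¬ ((∀ j : Fin N, j ≠ i → (1 - 1 / 1000) * a ≤ dist (x N i) (x N j)) ∧ Nat.card {j : Fin N // j ≠ i ∧ dist (x N i) (x N j) ≤ (1 + 1 / 1000) * a} = 12)} : ℝ) / N) Filter.atTop (nhds 0)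

/-- item stmt-AtomisticToContinuum-3374 · crux · rank 5 · closed · moot by None · by planner
why it might fail: Stacking blindness: close-packed shells never fix the stacking (KissingTwelveDegeneracy); if optimal LJ stackings are aperiodic (Hägg domination fails, |J₂|≈7e-5 uncertified) the implication is false even though LocalClosePacking holds.
sources: Literature.Barriers.AtomisticToContinuum.KissingTwelveDegeneracy, Literature.Barriers.AtomisticToContinuum.ShortRangeStackingBlindness, stmt-AtomisticToContinuum-0716, stmt-AtomisticToContinuum-0737, arXiv:1705.01751, HalesDSP2012 §1.3
[crux] HINGE: if Lennard-Jones ground states are locally close-packed (LocalClosePacking) and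
uniformly separated (LennardJonesMinimalDistance, named fact), then IsCrystallizing lennardJones 3:
local limits of translated ground states are windows of one lattice-periodic configuration. Content:
FCC/HCP-close shells ⇒ combinatorial Barlow layering (HalesDSP §1.3, discharged in tree as
HalesDSP_layerPackings_holds at η = 0) ⇒ stacking selection by the r⁻⁶ tail (Hägg domination
0716/0737 + certified interlayer couplings 0670) ⇒ periodic (HCP-type) limit. [deps:
LocalClosePacking] [difficulty: XL] -/
@[route_item "route-AtomisticToContinuum-TwoCentreKissing"]
def ClosePackedCrystallizes : Prop :=
  LocalClosePacking → Literature.MathematicalPhysics.StatisticalMechanics.LennardJonesMinimalDistance → Literature.MathematicalPhysics.StatisticalMechanics.IsCrystallizing Literature.MathematicalPhysics.StatisticalMechanics.lennardJones 3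

/-- item stmt-AtomisticToContinuum-0626 · support · rank 9 · open · by planner
sources: arXiv:1504.01153 §2.1, stmt-AtomisticToContinuum-0626
Energetic crystallization: E(N)/N converges to the infimum over periodic (multi-lattice)
configurations of the LJ energy per particle in d = 3. Lower bound liminf ≥ ⨅ is the content ((a)
local optimality + (d) + surface term O(N^{2/3})); upper bound is filed separately. -/
@[route_item "route-AtomisticToContinuum-TwoCentreKissing"]
def CrysEnergyLimit : Prop :=
  Filter.Tendsto (fun N : ℕ => Literature.MathematicalPhysics.StatisticalMechanics.groundStateEnergy Literature.MathematicalPhysics.StatisticalMechanics.lennardJones 3 N / N) Filter.atTop (nhds (⨅ Q : Literature.MathematicalPhysics.StatisticalMechanics.PeriodicConfiguration 3, Q.energyPerParticle Literature.MathematicalPhysics.StatisticalMechanics.lennardJones))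

/-- item stmt-AtomisticToContinuum-0627 · support · rank 9 · open · by planner
sources: arXiv:1504.01153 §2.5, stmt-AtomisticToContinuum-0627
The infimum over periodic configurations of ℝ³ of the Lennard-Jones energy per particle is attained
(by some lattice G and finite motif F). Needs stacking selection (c) + compactness of near-optimal
periodic configurations at bounded density / bounded-below distances; refuted if optimal LJ
stackings are aperiodic with unattained infimum (route RefuteCrystalPeriodicMin). -/
@[route_item "route-AtomisticToContinuum-TwoCentreKissing"]
def CrysPeriodicMinAttained : Prop :=
  ∃ P : Literature.MathematicalPhysics.StatisticalMechanics.PeriodicConfiguration 3, IsLeast (Set.range fun Q : Literature.MathematicalPhysics.StatisticalMechanics.PeriodicConfiguration 3 => Q.energyPerParticle Literature.MathematicalPhysics.StatisticalMechanics.lennardJones) (P.energyPerParticle Literature.MathematicalPhysics.StatisticalMechanics.lennardJones)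

/-- item stmt-AtomisticToContinuum-3375 · support · rank 9 · closed · moot by None · by planner
sources: arXiv:1407.0692 Conjecture 2.2, arXiv:1209.6043 Lemma 1-2, doi:10.1016/j.ejc.2008.07.017
[support] Soft two-centre lemma, tolerance η ∈ [0, 1/1000] (η = 0 is literally TwoCentreFourCommon):
Z (1−η)-separated, z ≠ z' with dist ≤ 1+η, each with exactly twelve other points within 1+η ⇒ ≥ 4
points within 1+η of both. From TwoCentreFourCommon + kissing number twelve only an ineffective η₀
follows by compactness (limit 13th contact excluded by k(3)=12); the explicit 1/1000 needs the
certificate with slack (soft L12 gap 1.26−24η = 1.236 at η = 10⁻³ keeps the cap-code reduction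
alive). [difficulty: L] -/
@[route_item "route-AtomisticToContinuum-TwoCentreKissing", crux]
def SoftTwoCentreFourCommon : Prop :=
  ∀ η : ℝ, 0 ≤ η → η ≤ 1 / 1000 → ∀ Z : Set (EuclideanSpace ℝ (Fin 3)), (∀ x ∈ Z, ∀ y ∈ Z, x ≠ y → 1 - η ≤ dist x y) → ∀ z ∈ Z, ∀ z' ∈ Z, z ≠ z' → dist z z' ≤ 1 + η → {w ∈ Z | w ≠ z ∧ dist w z ≤ 1 + η}.ncard = 12 → {w ∈ Z | w ≠ z' ∧ dist w z' ≤ 1 + η}.ncard = 12 → 4 ≤ {w ∈ Z | w ≠ z ∧ w ≠ z' ∧ dist w z ≤ 1 + η ∧ dist w z' ≤ 1 + η}.ncard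

/-- item stmt-AtomisticToContinuum-3376 · support · rank 9 · closed · moot by None · by planner
sources: doi:10.1016/j.cam.2013.03.036, arXiv:1407.0692 Prop 3.3, arXiv:1209.6043 Lemma 9-10, Literature.Geometry.DiscreteGeometry.kissingConfigCongruent_of_contactGraphFccOrHcp
[support] Effective 24-tangency rigidity (FT Thm 3.5 = FTTT 2013 with explicit slack; FT Prop 3.3(2)
made effective): for η ∈ [0, 1/1000], twelve points with norms in [1−η, 1+η], pairwise ≥ 1−η, and ≥
48 ordered pairs at distance ≤ 1+η are 1/10-close after a linear isometry to the FCC or the HCP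
kissing pattern. In the kernel's setting the soft L12 gap makes the shell a soft class-𝒱
configuration, where node degree ≤ 4 is in tree (IsKissingConfig.degree_le_four) and the 4-regular
case of Hales's Lemma 9 classification (TameContactGraphs.lean) is the natural Lean route.
[difficulty: L] -/
@[route_item "route-AtomisticToContinuum-TwoCentreKissing"]
def RobustTangencyBound : Prop :=
  ∀ η : ℝ, 0 ≤ η → η ≤ 1 / 1000 → ∀ T : Finset (EuclideanSpace ℝ (Fin 3)), T.card = 12 → (∀ y ∈ T, 1 - η ≤ ‖y‖ ∧ ‖y‖ ≤ 1 + η) → (∀ y ∈ T, ∀ y' ∈ T, y ≠ y' → 1 - η ≤ dist y y') → 48 ≤ Nat.card {q : ↥T × ↥T // q.1 ≠ q.2 ∧ dist (q.1 : EuclideanSpace ℝ (Fin 3)) q.2 ≤ 1 + η} → Literature.Geometry.DiscreteGeometry.ShellCloseTo (1 / 10) T Literature.Geometry.DiscreteGeometry.fccKissingPattern ∨ Literature.Geometry.DiscreteGeometry.ShellCloseTo (1 / 10) T Literature.Geometry.DiscreteGeometry.hcpKissingPattern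

/-- item stmt-AtomisticToContinuum-3377 · support · rank 9 · closed · moot by None · by planner
sources: arXiv:1407.0692 §2.1 (remark after Conjecture 2.2)
[support] Glue of the foreseen split of GapFreeShellRigidity: SoftTwoCentreFourCommon →
RobustTangencyBound → GapFreeShellRigidity (apply the soft lemma to Z = S ∩ B(x,4) and each pair
(x,y), y a soft neighbour: ≥ 4 soft-common neighbours give y−x ≥ 4 soft-tangent partners in the
translated shell T, card T = 12, so ≥ 48 ordered pairs). Finite-set bookkeeping, provable now.
[difficulty: provable-now] -/
@[route_item "route-AtomisticToContinuum-TwoCentreKissing"]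
def KernelGlue : Prop :=
  SoftTwoCentreFourCommon → RobustTangencyBound → GapFreeShellRigidity

/-- item stmt-AtomisticToContinuum-3378 · support · rank 9 · closed · moot by None · by planner
sources: arXiv:1504.01153 §2.1
[support] Glue: BondOrderTwelve → GapFreeShellRigidity → LocalClosePacking. Rescale a ground state
by 1/a; a particle whose (4a)-neighbourhood consists of bond-good particles satisfies the kernel's
hypotheses at η = 10⁻³; each bond-bad particle spoils ≤ (4.5/0.4995)³ good ones (volume packing), so
o(N) bad ⇒ o(N) non-close-packed; ground states are injective so index sets and point sets match.
[difficulty: M] -/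
@[route_item "route-AtomisticToContinuum-TwoCentreKissing"]
def BondToShells : Prop :=
  BondOrderTwelve → GapFreeShellRigidity → LocalClosePacking

/-- item stmt-AtomisticToContinuum-3379 · assembly · rank 1 · closed · moot by None · by planner
sources: Literature.StatMech.crystallization_of_isLeast_tendsto_isCrystallizing
[assembly] TwoCentreFourCommon → GapFreeShellRigidity → BondOrderTwelve → BondToShells →
ClosePackedCrystallizes → LennardJonesMinimalDistance → CrysPeriodicMinAttained → CrysEnergyLimit →
Crystallization -/
@[route_item "route-AtomisticToContinuum-TwoCentreKissing"]
def Assembly : Prop :=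
  TwoCentreFourCommon → GapFreeShellRigidity → BondOrderTwelve → BondToShells → ClosePackedCrystallizes → Literature.MathematicalPhysics.StatisticalMechanics.LennardJonesMinimalDistance → CrysPeriodicMinAttained → CrysEnergyLimit → Literature.MathematicalPhysics.StatisticalMechanics.Crystallization

end Summit.AtomisticToContinuum.Crystallization.Theses.TwoCentreKissing
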